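import Literature.MathematicalPhysics.QuantumFieldTheory.Balaban1983to89.B9Thm31GpAgmonGradDecayZd
import Literature.MathematicalPhysics.QuantumFieldTheory.Balaban1983to89.B9Eq326GaugeTermSquareZd

/-!
# `Balaban1983to89.B9Thm31GpAgmonDivDecayZd` — [Balaban1985BackgroundPropagators] Thm 3.1 (3.42) p. 397, THE DIVERGENCE ENTRY `n = 2` BY DUALITY:
# ★★★ `|(G′(U₀)·𝟙_{Ω₀}D^{η*}_{U₀}A)(x)|_τ ≤ Σ_{bonds b} K_x(b)·|A(b)|_τ` whenever the gradient of the kernel obeys `|(D_bG′(U₀)δ_x v)|_τ ≤ K_x(b)|v|_τ` — so the `n = 1`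
# bound of `B9Thm31GpAgmonGradDecayZd` TRANSPOSES to print's third entry `|(G′∇*_Uλ)(x)| ≤ B₀·Lʲη·e^{−δ₀d}|λ|`; UNCONDITIONAL explicit edition at every cube member for `G′(1)`

statement-level skeleton of published theorems with citation tags; proofs where landed; nothing here is a claim about the
Yang–Mills mass gap

`[Balaban1985BackgroundPropagators]` ("B9", CMP **99** (1985) 389–434) Thm 3.1 p. 397, (3.42) p. 397: the THIRD entry *«|(G′(U)∇*_Uλ)(x)| ≤ B₀Lʲηe^{−δ₀d(y,y′)}|λ|»*
(`B9.pref4 = [(Lʲη)², Lʲη, Lʲη, 1]`), p. 391 (*«the operators ∇_U, ∇*_U are adjoint to each other with respect to the natural L² scalar products»*).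
THIS FILE is the transposition step: `G′(U₀)` is symmetric for `⟨·,·⟩_τ` (`B9Eq324DeltaPrimeAZd.formE_GpZd_symm`) and `D^{η*}_{U₀}` is the adjoint of `D^η_{U₀}`
(`B9Eq326GaugeTermSquareZd.finsum_re_trace_bond_covDerivFwd`), so `Re τ(v*·(G′𝟙_{Ω₀}D*A)(x)) = Σ_μΣ_y Re τ(A(y,μ)*·(D_μG′δ_x v)(y))`; testing against
`v = (G′𝟙_{Ω₀}D*A)(x)` itself turns any gradient bound on the kernel (FILE 13) into the divergence entry.

CITATION HEADER (lean-in-tree rule).  Cell `pub-ymgap` (YM Track A, HUMAN RULING D-0062 ∕ D-0149 width push), DAG node N06 = [B9], width seat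
`pub-ymgap-dag-n06-w2` (g5), CLAIM-14.  Inputs BY NAME: `formE_GpZd_symm` (carrier), `finsum_re_trace_bond_covDerivFwd` (dag-n06 [B9] seat), `abs_fibreForm_le`,
FILE 13 `fnorm_covDerivFwd_GpZd_single_le_exp_coarse ∕ fnorm_covDerivFwd_GpZd_one_single_le_exp_cubeMember`.  Nothing restated.

WHAT IS PROVED (kernel, 0 sorry, 0 def; no `instance`, no `notation`).
* §1 ★★ `re_trace_GpZd_restrict_covDivB_eq` — the duality identity above (unitary `U₀`, tracial Hermitian faithful `τ`, finitely supported bond field `A`, `x ∈ Ω₀`).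
* §2 ★★★ `fnorm_GpZd_restrict_covDivB_le_of_grad` — the abstract transposition: a gradient bound `K_x(y,μ)` on the bonds carrying `A` gives
  `|(G′𝟙_{Ω₀}D*A)(x)|_τ ≤ Σ_μΣ_{y∈T}K_x(y,μ)|A(y,μ)|_τ` (`T ⊇` the sites carrying `A`).
* §3 ★★★ `fnorm_GpZd_restrict_covDivB_le_exp_coarse` — with FILE 13's coarsest-scale gradient bound (displayed `hco∕hB∕hA`, `κ(6dB+15A) ≤ θc₀`):
  `|(G′(U₀)𝟙_{Ω₀}D*A)(x)|_τ ≤ 4√(B(c₀+9κ²B))∕((1−θ)c₀)·(ηLᵐ)·Σ_μΣ_{y∈T}e^{−κL^{−m}|y−x|_∞}|A(y,μ)|_τ` (bond heads `y + e_μ ∈ Ω₀`);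
  ★★★ `fnorm_GpZd_one_restrict_covDivB_le_exp_cubeMember` — UNCONDITIONAL at every cube member for the flat background: the same with `10∕√m₈`;
  ★★ `fnorm_GpZd_one_restrict_covDivB_bond_le_exp_cubeMember` — ONE bond `b = (z, z+e_ν)` carrying `X`: `≤ (10∕√m₈)(ηLᵐ)e^{−κL^{−m}|z−x|_∞}|X|_τ`, print's display.

HONEST SCOPE.  (i) Single coarsest-scale rate and amplitude; NOT print's multi-scale `Lʲη e^{−δ₀d(y,y′)}`; (ii) the bond HEADS must lie in `Ω₀` (FILE 13 (ii)); (iii) §3's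
member edition is the FLAT background (the class edition is the same lines on FILE 12's data, not typed); (iv) NOT the sup∕Hölder entries (3.43)–(3.45), NOT Thm 3.2∕3.3.
Count-neutral; N05 ∕ N06 NOT discharged; K1⁹ `stmt-QuantumFields-27364` NOT closed; one finite `𝕋⁴` programme at fixed `ε`, Bałaban as printed; R4 closes only the
conditional finite-`𝕋⁴` rung `BalabanLadder.UV` — nothing continuum ∕ ℝ⁴ ∕ OS ∕ mass gap ∕ Clay.  Unit `pub-ymgap-dag-n06-w2` (g5), 2026-08-28.
-/

noncomputable section

open scoped BigOperators

namespace Literature.MathematicalPhysics.QuantumFieldTheory.Balaban1983to89.B9Thm31GpAgmonDivDecayZd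

open B7Prop1Explicit (e)
open B7Prop2Explicit (unitaryUnits)
open B8Ineq132 (covDerivFwd)
open B8Eq138LandauZd (covDivB)
open B8Eq119TwistedAxial (bgT)
open B8Eq131CubesAdmissible (cubeFam)
open B8LeafModelZd (ZdIdx)
open B8Eq191FlatLettersCubeMember (cubeLamS_finite)
open B9Thm311PosDefOpenZd (cubeMember_Ω0_finite)
open B9Eq321LandauProjectionZd (suppSub formE formE_apply)
open B9Eq324DeltaPrimeAZd (single restrictSite restrictSite_coe deltaPrimeADom GpZd fibreForm fibreForm_apply fibreForm_comm)
open B9Eq325QprimeSingleSiteZd (blockMapIter)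
open B9Eq342CombesThomasFormZd
open B9Eq326GaugeTermSquareZd (finsum_re_trace_bond_covDerivFwd)
open B9Thm31GpAgmonGradDecayZd (fnorm_covDerivFwd_GpZd_single_le_exp_coarse fnorm_covDerivFwd_GpZd_one_single_le_exp_cubeMember)
open LatticeNorms (linfDist)

export B7Prop1Explicit (Site)

variable {d : ℕ} {𝔸 : Type*} [CStarAlgebra 𝔸]

/-! ## §1  The duality identity -/

section Duality

variable (L : ℕ) (U₀ : Site d → Fin d → 𝔸ˣ) (η : ℝ) (τ : 𝔸 →ₗ[ℂ] ℂ) [FiniteDimensional ℝ 𝔸]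
  (hτp : ∀ a : 𝔸, a ≠ 0 → 0 < (τ (star a * a)).re) (m : ℕ) (a : ℕ → ℝ) (Λ : ℕ → Finset (Site d)) (s : Finset (Site d))

/-- ★★ **DUALITY**: for a unitary `U₀` (with unitary averaged transporters, `a ≥ 0`), a tracial Hermitian faithful `τ`, a finitely supported bond field `A` and `x ∈ Ω₀`,
`Re τ(v*·(G′(U₀)𝟙_{Ω₀}D^{η*}_{U₀}A)(x)) = Σ_μ Σᶠ_y Re τ(A(y,μ)*·(D^η_{U₀,μ}G′(U₀)δ_x v)(y))` — the symmetry of `G′` and the adjointness `(D^η)* = D^{η*}`.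
[cite: Balaban1985BackgroundPropagators, p.391 («∇_U, ∇*_U are adjoint»), (3.24)–(3.25) p.394, (3.42) p.397] -/
theorem re_trace_GpZd_restrict_covDivB_eq (hd : 0 < d) (hη : η ≠ 0) (hτt : ∀ a b : 𝔸, τ (a * b) = τ (b * a))
    (hτs : ∀ a : 𝔸, τ (star a) = starRingEnd ℂ (τ a)) (hU : ∀ (x : Site d) (κ : Fin d), U₀ x κ ∈ unitaryUnits 𝔸) (ha : ∀ j, 0 ≤ a j)
    {A : Site d → Fin d → 𝔸} (hA : ∀ μ : Fin d, (Function.support fun y => A y μ).Finite) {x : Site d} (hx : x ∈ s) (v : 𝔸) :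
    (τ (star v * (GpZd L U₀ η τ hτp m a Λ s hd hη hτt hτs hU ha (restrictSite s (covDivB η U₀ A)) : Site d → 𝔸) x)).re =
      ∑ μ : Fin d, ∑ᶠ y, (τ (star (A y μ) *
        covDerivFwd η U₀ μ (GpZd L U₀ η τ hτp m a Λ s hd hη hτt hτs hU ha (restrictSite s (single x v)) : Site d → 𝔸) y)).re := by
  classical
  set G := GpZd L U₀ η τ hτp m a Λ s hd hη hτt hτs hU ha with hG
  set Ψ : suppSub (𝔸 := 𝔸) s := restrictSite s (covDivB η U₀ A) with hΨ
  set δ : suppSub (𝔸 := 𝔸) s := restrictSite s (single x v) with hδ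
  set F : Site d → 𝔸 := (G δ : Site d → 𝔸) with hF
  -- `Re τ(v* (GΨ)(x)) = ⟨δ_x v, GΨ⟩`
  have h1 : (τ (star v * (G Ψ : Site d → 𝔸) x)).re = formE τ s δ (G Ψ) := by
    rw [formE_apply, Finset.sum_eq_single_of_mem x hx]
    · rw [hδ, restrictSite_single_coe hx, single_apply_self]
    · intro y _ hyx
      rw [hδ, restrictSite_single_coe hx, single_apply_of_ne hyx, star_zero, zero_mul, map_zero, Complex.zero_re]
  -- symmetry of `G′`
  have h2 : formE τ s δ (G Ψ) = formE τ s (G δ) Ψ :=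
    (B9Eq324DeltaPrimeAZd.formE_GpZd_symm (L := L) (m := m) (Λ := Λ) hd hη hτt hτs hU ha δ Ψ).symm
  -- `⟨Gδ, 𝟙D*A⟩ = Σᶠ_y Re τ((D*A)(y)* F(y))`
  have hFs : ∀ y, y ∉ s → F y = 0 := fun y hy => (G δ).2 y hy
  have h3 : formE τ s (G δ) Ψ = ∑ᶠ y, (τ (star (covDivB η U₀ A y) * F y)).re := by
    rw [formE_apply]
    have hsupp : (Function.support fun y => (τ (star (covDivB η U₀ A y) * F y)).re) ⊆ ↑s := by
      intro y hy
      rw [Function.mem_support] at hy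
      by_contra hys
      apply hy
      rw [hFs y (fun h => hys (Finset.mem_coe.2 h)), mul_zero, map_zero, Complex.zero_re]
    rw [finsum_eq_sum_of_support_subset _ hsupp]
    refine Finset.sum_congr rfl fun y hy => ?_
    have hΨy : (Ψ : Site d → 𝔸) y = covDivB η U₀ A y := by
      rw [hΨ, restrictSite_coe]; exact Set.indicator_of_mem (Finset.mem_coe.2 hy) _
    rw [hΨy]
    -- Hermitian symmetry of the fibre pairing
    have hc := fibreForm_comm τ hτs (F y) (covDivB η U₀ A y)
    simp only [fibreForm_apply] at hc
    exact hc
  rw [h1, h2, h3, ← finsum_re_trace_bond_covDerivFwd τ η hτt hU hA F]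

end Duality

/-! ## §2  The transposition: a gradient bound on the kernel gives the divergence entry -/

section Transpose

variable (L : ℕ) (U₀ : Site d → Fin d → 𝔸ˣ) (η : ℝ) (τ : 𝔸 →ₗ[ℂ] ℂ) [FiniteDimensional ℝ 𝔸]
  (hτp : ∀ a : 𝔸, a ≠ 0 → 0 < (τ (star a * a)).re) (m : ℕ) (a : ℕ → ℝ) (Λ : ℕ → Finset (Site d)) (s : Finset (Site d))

omit [CStarAlgebra 𝔸] in
/-- `t² ≤ c·t`, `c ≥ 0` ⟹ `t ≤ c`. [folklore] [cite: Balaban1985BackgroundPropagators, (3.42) p.397 (bookkeeping)] -/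
theorem le_of_sq_le_mul_self {t c : ℝ} (hc : 0 ≤ c) (h : t ^ 2 ≤ c * t) : t ≤ c := by
  by_contra hle
  have hlt : c < t := lt_of_not_ge hle
  have htpos : 0 < t := hc.trans_lt hlt
  have : c * t < t * t := mul_lt_mul_of_pos_right hlt htpos
  nlinarith

/-- ★★★ **THE DIVERGENCE ENTRY FROM A GRADIENT BOUND ON THE KERNEL.**  Unitary `U₀` (unitary averaged transporters, `a ≥ 0`), tracial Hermitian faithful `τ`; a finitely
supported bond field `A` whose carrying sites lie in `T`; `x ∈ Ω₀`; and a bond weight `K ≥ 0` with `|(D^η_{U₀,μ}G′(U₀)δ_x v)(y)|_τ ≤ K(y,μ)·|v|_τ` for all `v` and all bonds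
`(y,μ)` carrying `A`.  THEN `|(G′(U₀)𝟙_{Ω₀}D^{η*}_{U₀}A)(x)|_τ ≤ Σ_μ Σ_{y∈T} K(y,μ)·|A(y,μ)|_τ`.
[cite: Balaban1985BackgroundPropagators, Thm 3.1 p.397, (3.42) p.397 (third entry), p.391] -/
theorem fnorm_GpZd_restrict_covDivB_le_of_grad (hd : 0 < d) (hη : η ≠ 0) (hτt : ∀ a b : 𝔸, τ (a * b) = τ (b * a))
    (hτs : ∀ a : 𝔸, τ (star a) = starRingEnd ℂ (τ a)) (hU : ∀ (x : Site d) (κ : Fin d), U₀ x κ ∈ unitaryUnits 𝔸) (ha : ∀ j, 0 ≤ a j)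
    {A : Site d → Fin d → 𝔸} {T : Finset (Site d)} (hT : ∀ (y : Site d) (μ : Fin d), A y μ ≠ 0 → y ∈ T) {x : Site d} (hx : x ∈ s)
    {K : Site d → Fin d → ℝ} (hK0 : ∀ y μ, 0 ≤ K y μ)
    (hgrad : ∀ (v : 𝔸) (y : Site d) (μ : Fin d), A y μ ≠ 0 →
      fnorm τ (covDerivFwd η U₀ μ (GpZd L U₀ η τ hτp m a Λ s hd hη hτt hτs hU ha (restrictSite s (single x v)) : Site d → 𝔸) y) ≤ K y μ * fnorm τ v) :
    fnorm τ ((GpZd L U₀ η τ hτp m a Λ s hd hη hτt hτs hU ha (restrictSite s (covDivB η U₀ A)) : Site d → 𝔸) x) ≤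
      ∑ μ : Fin d, ∑ y ∈ T, K y μ * fnorm τ (A y μ) := by
  classical
  have hA : ∀ μ : Fin d, (Function.support fun y => A y μ).Finite := fun μ =>
    (T.finite_toSet).subset fun y hy => Finset.mem_coe.2 (hT y μ (Function.mem_support.1 hy))
  set u : 𝔸 := (GpZd L U₀ η τ hτp m a Λ s hd hη hτt hτs hU ha (restrictSite s (covDivB η U₀ A)) : Site d → 𝔸) x with hu
  set C : ℝ := ∑ μ : Fin d, ∑ y ∈ T, K y μ * fnorm τ (A y μ) with hC
  have hC0 : 0 ≤ C := Finset.sum_nonneg fun μ _ => Finset.sum_nonneg fun y _ => mul_nonneg (hK0 y μ) (fnorm_nonneg τ _)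
  refine le_of_sq_le_mul_self hC0 ?_
  -- `|u|² = Re τ(u* u) = Σ_μ Σᶠ_y Re τ(A(y,μ)* (D_μ G′δ_x u)(y))`
  rw [fnorm_sq hτp u, hu, re_trace_GpZd_restrict_covDivB_eq L U₀ η τ hτp m a Λ s hd hη hτt hτs hU ha hA hx]
  set Fu : Site d → 𝔸 := (GpZd L U₀ η τ hτp m a Λ s hd hη hτt hτs hU ha (restrictSite s (single x u)) : Site d → 𝔸) with hFu
  -- each direction: `finsum` over the support `⊆ T`, then Cauchy–Schwarz and the gradient bound
  have hdir : ∀ μ : Fin d, ∑ᶠ y, (τ (star (A y μ) * covDerivFwd η U₀ μ Fu y)).re ≤ ∑ y ∈ T, K y μ * fnorm τ (A y μ) * fnorm τ u := by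
    intro μ
    have hsupp : (Function.support fun y => (τ (star (A y μ) * covDerivFwd η U₀ μ Fu y)).re) ⊆ ↑T := by
      intro y hy
      rw [Function.mem_support] at hy
      by_contra hyT
      apply hy
      have hA0 : A y μ = 0 := by
        by_contra h
        exact hyT (Finset.mem_coe.2 (hT y μ h))
      rw [hA0, star_zero, zero_mul, map_zero, Complex.zero_re]
    rw [finsum_eq_sum_of_support_subset _ hsupp]
    refine Finset.sum_le_sum fun y _ => ?_
    by_cases hA0 : A y μ = 0
    · rw [hA0, star_zero, zero_mul, map_zero, Complex.zero_re, fnorm_zero, mul_zero, zero_mul]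
    · calc (τ (star (A y μ) * covDerivFwd η U₀ μ Fu y)).re ≤ |(τ (star (A y μ) * covDerivFwd η U₀ μ Fu y)).re| := le_abs_self _
        _ ≤ fnorm τ (A y μ) * fnorm τ (covDerivFwd η U₀ μ Fu y) := abs_fibreForm_le hτp hτs _ _
        _ ≤ fnorm τ (A y μ) * (K y μ * fnorm τ u) := mul_le_mul_of_nonneg_left (hgrad u y μ hA0) (fnorm_nonneg τ _)
        _ = K y μ * fnorm τ (A y μ) * fnorm τ u := by ring
  calc ∑ μ : Fin d, ∑ᶠ y, (τ (star (A y μ) * covDerivFwd η U₀ μ Fu y)).re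
      ≤ ∑ μ : Fin d, ∑ y ∈ T, K y μ * fnorm τ (A y μ) * fnorm τ u := Finset.sum_le_sum fun μ _ => hdir μ
    _ = C * fnorm τ u := by rw [hC, Finset.sum_mul]; exact Finset.sum_congr rfl fun μ _ => by rw [Finset.sum_mul]

end Transpose

/-! ## §3  The coarsest scale, and the unconditional edition at a cube member -/

section Coarse

variable (L : ℕ) (U₀ : Site d → Fin d → 𝔸ˣ) (η : ℝ) (τ : 𝔸 →ₗ[ℂ] ℂ) [FiniteDimensional ℝ 𝔸]
  (hτp : ∀ a : 𝔸, a ≠ 0 → 0 < (τ (star a * a)).re) (m : ℕ) (a : ℕ → ℝ) (Λ : ℕ → Finset (Site d)) (s : Finset (Site d))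

/-- ★★★ **[B9] THM 3.1's (3.42), n = 2 SHAPE, FOR THE GENUINE `G′(U₀)` AT THE `ℤᵈ` CARRIER, EXPLICIT MEMBER-UNIFORM CONSTANTS AT THE COARSEST SCALE.**  Data of FILE 13's
`fnorm_covDerivFwd_GpZd_single_le_exp_coarse` (`L ≥ 1`, `η > 0`, unitary `U₀` with unitary averaged transporters, `a ≥ 0`, displayed `hco`, scaling slots `hB` (`B > 0`), `hA`,
`0 ≤ θ < 1`, `0 ≤ κ ≤ 1`, `κ(6dB + 15A) ≤ θc₀`); a bond field `A` carried by sites in `T` whose bond heads lie in `Ω₀`; `x ∈ Ω₀`.  THEN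
`|(G′(U₀)𝟙_{Ω₀}D^{η*}_{U₀}A)(x)|_τ ≤ 4√(B(c₀ + 9κ²B))∕((1−θ)c₀)·(ηLᵐ)·Σ_μΣ_{y∈T} e^{−κL^{−m}|y−x|_∞}·|A(y,μ)|_τ`.
[cite: Balaban1985BackgroundPropagators, Thm 3.1 p.397, (3.42) p.397, (3.24) p.394, p.391; Agmon1982, Thm 1.5 p.19] -/
theorem fnorm_GpZd_restrict_covDivB_le_exp_coarse [NeZero L] (hd : 0 < d) (hη : η ≠ 0) (hL : 1 ≤ L) (hτt : ∀ a b : 𝔸, τ (a * b) = τ (b * a))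
    (hτs : ∀ a : 𝔸, τ (star a) = starRingEnd ℂ (τ a)) (hU : ∀ (x : Site d) (κ : Fin d), U₀ x κ ∈ unitaryUnits 𝔸)
    (hT : ∀ j', j' < m → ∀ z y : Site d, bgT L U₀ j' z y ∈ unitaryUnits 𝔸) (ha : ∀ j, 0 ≤ a j)
    {c₀ θ : ℝ} (hc₀ : 0 < c₀) (hθ0 : 0 ≤ θ) (hθ1 : θ < 1) {M : Site d → ℝ} (hM0 : ∀ z ∈ s, 0 ≤ M z)
    (hco : ∀ Φ : suppSub (𝔸 := 𝔸) s, c₀ * ∑ z ∈ s, M z * fnorm τ ((Φ : Site d → 𝔸) z) ^ 2 ≤ formE τ s Φ (deltaPrimeADom L U₀ η τ hτp m a Λ s Φ))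
    {A' B κ : ℝ} (hBpos : 0 < B) (hκ0 : 0 ≤ κ) (hκ1 : κ ≤ 1) (hκ : κ * (6 * d * B + 15 * A') ≤ θ * c₀)
    (hB : ∀ z ∈ s, (η⁻¹) ^ 2 * (((L : ℝ) ^ m)⁻¹) ^ 2 ≤ B * M z)
    (hA : ∀ z ∈ s, ∑ j ∈ Finset.range (m + 1), (if blockMapIter L j z ∈ Λ j then a j * (((L : ℝ) ^ d)⁻¹) ^ j else 0) ≤ A' * M z)
    (hηpos : 0 < η) {A : Site d → Fin d → 𝔸} {T : Finset (Site d)} (hTA : ∀ (y : Site d) (μ : Fin d), A y μ ≠ 0 → y ∈ T)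
    (hhead : ∀ (y : Site d) (μ : Fin d), A y μ ≠ 0 → y + e μ ∈ s) {x : Site d} (hx : x ∈ s) :
    fnorm τ ((GpZd L U₀ η τ hτp m a Λ s hd hη hτt hτs hU ha (restrictSite s (covDivB η U₀ A)) : Site d → 𝔸) x) ≤
      4 * Real.sqrt (B * (c₀ + 9 * κ ^ 2 * B)) / ((1 - θ) * c₀) * (η * (L : ℝ) ^ m) *
        ∑ μ : Fin d, ∑ y ∈ T, Real.exp (-(κ * (((L : ℝ) ^ m)⁻¹ * ((linfDist y x : ℕ) : ℝ)))) * fnorm τ (A y μ) := by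
  have hθ' : 0 < 1 - θ := by linarith
  have hL0 : (0 : ℝ) < L := by exact_mod_cast hL
  set c : ℝ := 4 * Real.sqrt (B * (c₀ + 9 * κ ^ 2 * B)) / ((1 - θ) * c₀) * (η * (L : ℝ) ^ m) with hc
  have hcpos : 0 ≤ c := by
    have : 0 ≤ Real.sqrt (B * (c₀ + 9 * κ ^ 2 * B)) := Real.sqrt_nonneg _
    positivity
  have h := fnorm_GpZd_restrict_covDivB_le_of_grad L U₀ η τ hτp m a Λ s hd hη hτt hτs hU ha hTA hx
    (K := fun y _ => c * Real.exp (-(κ * (((L : ℝ) ^ m)⁻¹ * ((linfDist y x : ℕ) : ℝ)))))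
    (fun y μ => mul_nonneg hcpos (Real.exp_pos _).le)
    (fun v y μ hyμ => by
      have hg := fnorm_covDerivFwd_GpZd_single_le_exp_coarse L U₀ η τ hτp m a Λ s hd hη hL hτt hτs hU hT ha hc₀ hθ0 hθ1 hM0 hco hBpos hκ0 hκ1 hκ
        hB hA hηpos hx v μ (hhead y μ hyμ)
      simpa only [hc, mul_assoc] using hg)
  refine h.trans (le_of_eq ?_)
  rw [Finset.mul_sum]
  refine Finset.sum_congr rfl fun μ _ => ?_
  rw [Finset.mul_sum]
  refine Finset.sum_congr rfl fun y _ => ?_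
  ring

end Coarse

section CubeMember

variable (L : ℕ) (τ : 𝔸 →ₗ[ℂ] ℂ) [FiniteDimensional ℝ 𝔸] (hτp : ∀ a : 𝔸, a ≠ 0 → 0 < (τ (star a * a)).re)

/-- ★★★ **[B9] THM 3.1's (3.42), n = 2 SHAPE, FOR `G′(1)` AT EVERY CUBE MEMBER — UNCONDITIONAL, MEMBER-UNIFORM EXPLICIT CONSTANTS.**  `2 ≤ L ≤ ρc`, `m ≤ i.k`,
`τ` tracial Hermitian faithful on a finite-dimensional nontrivial fibre, print-scaled weights `a_lo(Lᵈ)ʲ(ηLʲ)⁻² ≤ a_j ≤ a_hi(Lᵈ)ʲ(ηLʲ)⁻²` (`j ≤ m`), `m₈ = min{8, a_lo}`,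
`0 ≤ κ ≤ 1` with `κ(12d + 30a_hi) ≤ m₈`; a bond field `A` carried by `T` with bond heads in `□₀`; `x ∈ □₀`.  THEN
`|(G′(1)𝟙_{□₀}D^{η*}A)(x)|_τ ≤ (10∕√m₈)·(ηLᵐ)·Σ_μΣ_{y∈T} e^{−κL^{−m}|y−x|_∞}·|A(y,μ)|_τ`.
[cite: Balaban1985BackgroundPropagators, Thm 3.1 p.397, (3.42) p.397, (3.24) p.394; Balaban1985RegularSpaces, (1.131) p.99; Agmon1982, Thm 1.5 p.19] -/
theorem fnorm_GpZd_one_restrict_covDivB_le_exp_cubeMember [Nontrivial 𝔸] (hd : 0 < d) (hL : 2 ≤ L) (hτt : ∀ a b : 𝔸, τ (a * b) = τ (b * a))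
    (hτs : ∀ a : 𝔸, τ (star a) = starRingEnd ℂ (τ a)) (i : ZdIdx d L) {ac : Site d} {Mc ρc : ℕ} (hΩ : i.Ω = cubeFam false L ac Mc ρc i.k)
    (hρc : L ≤ ρc) {m : ℕ} (hm : m ≤ i.k) {a : ℕ → ℝ} (ha : ∀ j, 0 ≤ a j) {a_lo a_hi : ℝ} (halo : 0 < a_lo)
    (hlo : ∀ j ∈ Finset.range (m + 1), a_lo * ((L : ℝ) ^ d) ^ j * ((i.η * (L : ℝ) ^ j) ^ 2)⁻¹ ≤ a j)
    (hhi : ∀ j ∈ Finset.range (m + 1), a j ≤ a_hi * ((L : ℝ) ^ d) ^ j * ((i.η * (L : ℝ) ^ j) ^ 2)⁻¹)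
    {κ : ℝ} (hκ0 : 0 ≤ κ) (hκ1 : κ ≤ 1) (hκ : κ * (12 * d + 30 * a_hi) ≤ min 8 a_lo)
    {A : Site d → Fin d → 𝔸} {T : Finset (Site d)} (hTA : ∀ (y : Site d) (μ : Fin d), A y μ ≠ 0 → y ∈ T)
    (hhead : ∀ (y : Site d) (μ : Fin d), A y μ ≠ 0 → y + e μ ∈ (cubeMember_Ω0_finite i hΩ).toFinset)
    {x : Site d} (hx : x ∈ (cubeMember_Ω0_finite i hΩ).toFinset) :
    fnorm τ ((GpZd L (1 : Site d → Fin d → 𝔸ˣ) i.η τ hτp m a (fun j => (cubeLamS_finite L ac Mc ρc i.k m j).toFinset)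
        (cubeMember_Ω0_finite i hΩ).toFinset hd i.hη.ne' hτt hτs (fun _ _ => (unitaryUnits 𝔸).one_mem) ha
        (restrictSite (cubeMember_Ω0_finite i hΩ).toFinset (covDivB i.η (1 : Site d → Fin d → 𝔸ˣ) A)) : Site d → 𝔸) x) ≤
      10 / Real.sqrt (min 8 a_lo) * (i.η * (L : ℝ) ^ m) *
        ∑ μ : Fin d, ∑ y ∈ T, Real.exp (-(κ * (((L : ℝ) ^ m)⁻¹ * ((linfDist y x : ℕ) : ℝ)))) * fnorm τ (A y μ) := by
  have hL0 : (0 : ℝ) < L := by exact_mod_cast (lt_of_lt_of_le zero_lt_two hL)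
  have hm₈0 : 0 < min 8 a_lo := lt_min (by norm_num) halo
  set c : ℝ := 10 / Real.sqrt (min 8 a_lo) * (i.η * (L : ℝ) ^ m) with hc
  have hcpos : 0 ≤ c := by
    have := i.hη
    have : 0 < Real.sqrt (min 8 a_lo) := Real.sqrt_pos.2 hm₈0
    positivity
  have h := fnorm_GpZd_restrict_covDivB_le_of_grad L (1 : Site d → Fin d → 𝔸ˣ) i.η τ hτp m a
    (fun j => (cubeLamS_finite L ac Mc ρc i.k m j).toFinset) (cubeMember_Ω0_finite i hΩ).toFinset hd i.hη.ne' hτt hτs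
    (fun _ _ => (unitaryUnits 𝔸).one_mem) ha hTA hx
    (K := fun y _ => c * Real.exp (-(κ * (((L : ℝ) ^ m)⁻¹ * ((linfDist y x : ℕ) : ℝ)))))
    (fun y μ => mul_nonneg hcpos (Real.exp_pos _).le)
    (fun v y μ hyμ => by
      have hg := fnorm_covDerivFwd_GpZd_one_single_le_exp_cubeMember L τ hτp hd hL hτt hτs i hΩ hρc hm ha halo hlo hhi hκ0 hκ1 hκ μ
        (hhead y μ hyμ) hx v
      simpa only [hc, mul_assoc] using hg)
  refine h.trans (le_of_eq ?_)
  rw [Finset.mul_sum]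
  refine Finset.sum_congr rfl fun μ _ => ?_
  rw [Finset.mul_sum]
  refine Finset.sum_congr rfl fun y _ => ?_
  ring

/-- ★★ **ONE BOND** — PRINT'S DISPLAY OF THE THIRD ENTRY: for the bond field carrying `X` on the single bond `b = (z, z + e_ν)` (`z + e_ν ∈ □₀`) and `x ∈ □₀`,
`|(G′(1)𝟙_{□₀}D^{η*}δ_b X)(x)|_τ ≤ (10∕√m₈)·(ηLᵐ)·e^{−κL^{−m}|z−x|_∞}·|X|_τ` — `B₀·Lʲη·e^{−δ₀d(y,y′)}|λ|` at the coarsest scale with `B₀ = 10∕√m₈`, `δ₀ = κ`.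
[cite: Balaban1985BackgroundPropagators, Thm 3.1 p.397, (3.42) p.397 (third entry); Balaban1985RegularSpaces, (1.131) p.99; Agmon1982, Thm 1.5 p.19] -/
theorem fnorm_GpZd_one_restrict_covDivB_bond_le_exp_cubeMember [Nontrivial 𝔸] (hd : 0 < d) (hL : 2 ≤ L) (hτt : ∀ a b : 𝔸, τ (a * b) = τ (b * a))
    (hτs : ∀ a : 𝔸, τ (star a) = starRingEnd ℂ (τ a)) (i : ZdIdx d L) {ac : Site d} {Mc ρc : ℕ} (hΩ : i.Ω = cubeFam false L ac Mc ρc i.k)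
    (hρc : L ≤ ρc) {m : ℕ} (hm : m ≤ i.k) {a : ℕ → ℝ} (ha : ∀ j, 0 ≤ a j) {a_lo a_hi : ℝ} (halo : 0 < a_lo)
    (hlo : ∀ j ∈ Finset.range (m + 1), a_lo * ((L : ℝ) ^ d) ^ j * ((i.η * (L : ℝ) ^ j) ^ 2)⁻¹ ≤ a j)
    (hhi : ∀ j ∈ Finset.range (m + 1), a j ≤ a_hi * ((L : ℝ) ^ d) ^ j * ((i.η * (L : ℝ) ^ j) ^ 2)⁻¹)
    {κ : ℝ} (hκ0 : 0 ≤ κ) (hκ1 : κ ≤ 1) (hκ : κ * (12 * d + 30 * a_hi) ≤ min 8 a_lo)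
    (z : Site d) (ν : Fin d) (X : 𝔸) (hz : z + e ν ∈ (cubeMember_Ω0_finite i hΩ).toFinset)
    {x : Site d} (hx : x ∈ (cubeMember_Ω0_finite i hΩ).toFinset) :
    fnorm τ ((GpZd L (1 : Site d → Fin d → 𝔸ˣ) i.η τ hτp m a (fun j => (cubeLamS_finite L ac Mc ρc i.k m j).toFinset)
        (cubeMember_Ω0_finite i hΩ).toFinset hd i.hη.ne' hτt hτs (fun _ _ => (unitaryUnits 𝔸).one_mem) ha
        (restrictSite (cubeMember_Ω0_finite i hΩ).toFinset
          (covDivB i.η (1 : Site d → Fin d → 𝔸ˣ) (fun y μ => if y = z ∧ μ = ν then X else 0))) : Site d → 𝔸) x) ≤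
      10 / Real.sqrt (min 8 a_lo) * (i.η * (L : ℝ) ^ m) * Real.exp (-(κ * (((L : ℝ) ^ m)⁻¹ * ((linfDist z x : ℕ) : ℝ)))) * fnorm τ X := by
  classical
  have hTA : ∀ (y : Site d) (μ : Fin d), (fun y μ => if y = z ∧ μ = ν then X else (0 : 𝔸)) y μ ≠ 0 → y ∈ ({z} : Finset (Site d)) := by
    intro y μ h
    by_cases hy : y = z ∧ μ = ν
    · exact Finset.mem_singleton.2 hy.1
    · exact absurd (by simp only [hy, if_false]) h
  have hhead : ∀ (y : Site d) (μ : Fin d), (fun y μ => if y = z ∧ μ = ν then X else (0 : 𝔸)) y μ ≠ 0 →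
      y + e μ ∈ (cubeMember_Ω0_finite i hΩ).toFinset := by
    intro y μ h
    by_cases hy : y = z ∧ μ = ν
    · rw [hy.1, hy.2]; exact hz
    · exact absurd (by simp only [hy, if_false]) h
  have h := fnorm_GpZd_one_restrict_covDivB_le_exp_cubeMember L τ hτp hd hL hτt hτs i hΩ hρc hm ha halo hlo hhi hκ0 hκ1 hκ hTA hhead hx
  refine h.trans (le_of_eq ?_)
  -- the sum over `T = {z}` and the directions: only `μ = ν` carries `X`
  simp only [Finset.sum_singleton, true_and]
  rw [Finset.sum_eq_single_of_mem ν (Finset.mem_univ ν) (fun μ _ hμ => by rw [if_neg hμ, fnorm_zero, mul_zero]), if_pos rfl]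
  ring

end CubeMember

end Literature.MathematicalPhysics.QuantumFieldTheory.Balaban1983to89.B9Thm31GpAgmonDivDecayZd

end
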